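import Literature.Analysis.FluidPDE.OseenSchemeComplex
import Mathlib.MeasureTheory.Group.Integral
import HarnessLib

/-!
# Galilean covariance of the complexified Oseen scheme

Analysis/FluidPDE support file (one definition, the covariance predicate; everything proved), a
layer of the proof of the named fact `Literature.Analysis.FluidPDE.lemarieRieusset2016_local_analyticity`
(`NSBoundedMildAnalytic.lean`; Lemarié-Rieusset 2016, Thm. 9.12, proof pp. 260–263) on top of the
complexified scheme of `OseenSchemeComplex.lean` (root time `m`, `m² = νt`, complex Galilean
parameter `g`; operators `freeTermC`, `duhamelC` on `schemeDomain ν T₀`).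

The reason for the Galilean parameter `g` (the plan recorded in `NSBoundedMildAnalytic.lean`):
Oseen's scheme commutes with Galilean transformations, so the fixed point satisfies the **boost
identity** `U(m, g)(x + e) = U(m, g - m⁻² e)(x)` — translating the space point is the same as
shifting the Galilean parameter — and holomorphy in `g` becomes analyticity in `x`
(`OseenSchemeRealAnalytic.lean`). This file proves the covariance at the level of the operators:

* `IsGalileanCovariantOn D V`: `V q (z + e) = V (q.1, q.2 - (q.1²)⁻¹ cx e) z` whenever both
  parameters lie in `D`;
* `freeTermC_add_right`: the free term is covariant (for every `m ≠ 0`, `g`, real `e`: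
  the translation `y ↦ y + e` in `∫ 𝒢(m, y - m²g) b(x + e - y) dy`);
* `duhamelC_add_right`: the bilinear term of covariant fields is covariant on `schemeDomain ν T₀`
  (translation `y ↦ y + (1-θ)e` in the inner integral, the fields absorbing the remaining shift
  `θe` at root time `√θ m`: `(θm²)⁻¹(θe) = m⁻²e`), hence
* `IsGalileanCovariantOn.scheme`: the scheme map `V ↦ freeTermC b - duhamelC ν V V` preserves
  covariance, and `IsGalileanCovariantOn.of_tendsto`: covariance passes to pointwise limits.

Translation invariance of the Bochner integral on `ℝ^ι` needs no integrability, so no analytic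
hypothesis on the fields enters.

## Mathlib / tree search

Tree: `schemeDomain`, `sqrt_mul_mem_schemeDomain`, `freeTermC`, `duhamelC`
(`OseenSchemeComplex.lean`), `complexify_smul` (`OseenKernelComplex.lean`). Mathlib:
`integral_add_right_eq_self`, `integral_sub_right_eq_self` (Haar translation invariance),
`setIntegral_congr_fun`, `tendsto_nhds_unique`.

## References

* P. G. Lemarié-Rieusset, *The Navier–Stokes Problem in the 21st Century*, CRC Press 2016,
  doi:10.1201/b19556, Thm. 9.12 and its proof, PDF pp. 260–263. [LemarieRieusset2016]
-/

noncomputable section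

open MeasureTheory Set Filter Metric Real
open _root_.Topology
open scoped BigOperators

namespace Literature.Analysis.FluidPDE

open Literature.Analysis.FunctionSpaces.EuclideanSpace (complexify complexify_apply norm_complexify)

variable {ι : Type*} [Fintype ι]

/-! ### The covariance predicate -/

/-- **Galilean covariance** of a field `V : ℂ × ℂ^ι → ℝ^ι → ℂ^ι` on a parameter set `D`:
translating the space point by a real vector `e` is the same as shifting the Galilean parameter
by `-(m²)⁻¹ e`, `V (m, g) (z + e) = V (m, g - (m²)⁻¹ cx e) z`, whenever both parameters lie in
`D` (for real `m² = νt` and `g = 0`: `V(√(νt), -(νt)⁻¹e)(z) = V(√(νt), 0)(z + e)`, the Galilean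
transform). [folklore] -/
def IsGalileanCovariantOn (D : Set (ℂ × EuclideanSpace ℂ ι))
    (V : ℂ × EuclideanSpace ℂ ι → EuclideanSpace ℝ ι → EuclideanSpace ℂ ι) : Prop :=
  ∀ q ∈ D, ∀ z e : EuclideanSpace ℝ ι,
    ((q.1, q.2 - (q.1 ^ 2)⁻¹ • complexify e) : ℂ × EuclideanSpace ℂ ι) ∈ D →
      V q (z + e) = V (q.1, q.2 - (q.1 ^ 2)⁻¹ • complexify e) z

/-- Covariance is stable under pointwise limits (along a non-trivial filter). [folklore] -/
theorem IsGalileanCovariantOn.of_tendsto {D : Set (ℂ × EuclideanSpace ℂ ι)} {α : Type*}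
    {l : Filter α} [l.NeBot]
    {V : α → ℂ × EuclideanSpace ℂ ι → EuclideanSpace ℝ ι → EuclideanSpace ℂ ι}
    {U : ℂ × EuclideanSpace ℂ ι → EuclideanSpace ℝ ι → EuclideanSpace ℂ ι}
    (hV : ∀ a, IsGalileanCovariantOn D (V a))
    (hlim : ∀ q ∈ D, ∀ z, Tendsto (fun a => V a q z) l (𝓝 (U q z))) :
    IsGalileanCovariantOn D U := by
  intro q hq z e hq'
  have h1 := hlim q hq (z + e)
  have h2 := hlim _ hq' z
  have heq : (fun a => V a q (z + e)) = fun a => V a (q.1, q.2 - (q.1 ^ 2)⁻¹ • complexify e) z :=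
    funext fun a => hV a q hq z e hq'
  rw [heq] at h1
  exact tendsto_nhds_unique h1 h2

/-- Covariance is preserved by subtraction of fields. [folklore] -/
theorem IsGalileanCovariantOn.sub {D : Set (ℂ × EuclideanSpace ℂ ι)}
    {V W : ℂ × EuclideanSpace ℂ ι → EuclideanSpace ℝ ι → EuclideanSpace ℂ ι}
    (hV : IsGalileanCovariantOn D V) (hW : IsGalileanCovariantOn D W) :
    IsGalileanCovariantOn D (fun q z => V q z - W q z) := by
  intro q hq z e hq'
  simp only [hV q hq z e hq', hW q hq z e hq']

/-! ### Covariance of the free term -/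

/-- The shift algebra: `cx (y + e) - (m²) • g = cx y - (m²) • (g - (m²)⁻¹ • cx e)` for `m ≠ 0`.
[folklore] -/
theorem complexify_add_sub_smul {m : ℂ} (hm : m ≠ 0) (g : EuclideanSpace ℂ ι)
    (y e : EuclideanSpace ℝ ι) :
    complexify (y + e) - (m ^ 2) • g = complexify y - (m ^ 2) • (g - (m ^ 2)⁻¹ • complexify e) := by
  rw [map_add, smul_sub, smul_smul, mul_inv_cancel₀ (pow_ne_zero 2 hm), one_smul]
  abel

/-- **The free term is Galilean covariant**: for `m ≠ 0`, any `g` and real `x, e`,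
`freeTermC b (m, g) (x + e) = freeTermC b (m, g - (m²)⁻¹ cx e) x` (the translation `y ↦ y + e`
of the `y`-integral). [folklore] -/
theorem freeTermC_add_right (b : EuclideanSpace ℝ ι → EuclideanSpace ℝ ι) {m : ℂ} (hm : m ≠ 0)
    (g : EuclideanSpace ℂ ι) (x e : EuclideanSpace ℝ ι) :
    freeTermC b (m, g) (x + e) = freeTermC b (m, g - (m ^ 2)⁻¹ • complexify e) x := by
  unfold freeTermC
  simp only
  rw [← integral_add_right_eq_self (μ := (volume : Measure (EuclideanSpace ℝ ι)))
    (fun y => heatKernelC m (complexify y - (m ^ 2) • g) • complexify (b (x + e - y))) e]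
  refine integral_congr_ae (Eventually.of_forall fun y => ?_)
  simp only
  rw [complexify_add_sub_smul hm g y e, show x + e - (y + e) = x - y by abel]

/-- The free term is covariant on every parameter set avoiding `m = 0`, in particular on
`schemeDomain ν T₀`. [folklore] -/
theorem isGalileanCovariantOn_freeTermC (b : EuclideanSpace ℝ ι → EuclideanSpace ℝ ι) (ν T₀ : ℝ) :
    IsGalileanCovariantOn (schemeDomain ν T₀) (freeTermC b) := by
  intro q hq z e _
  have hm : q.1 ≠ 0 := fun h => by
    have := hq.1
    rw [h] at this
    simp at this
  exact freeTermC_add_right b hm q.2 z e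

/-! ### Covariance of the bilinear term -/

section Duhamel

variable {ν T₀ : ℝ}

/-- The shift algebra in the kernel of the bilinear term:
`cx (y + (1-θ)e) - ((1-θ)m²) • g = cx y - ((1-θ)m²) • (g - (m²)⁻¹ cx e)` (`m ≠ 0`). [folklore] -/
theorem complexify_add_smul_sub_smul {m : ℂ} (hm : m ≠ 0) (θ : ℝ) (g : EuclideanSpace ℂ ι)
    (y e : EuclideanSpace ℝ ι) :
    complexify (y + (1 - θ) • e) - ((((1 - θ : ℝ)) : ℂ) * m ^ 2) • g =
      complexify y - ((((1 - θ : ℝ)) : ℂ) * m ^ 2) • (g - (m ^ 2)⁻¹ • complexify e) := by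
  rw [map_add, complexify_smul, smul_sub, smul_smul, mul_assoc, mul_inv_cancel₀ (pow_ne_zero 2 hm),
    mul_one]
  abel

/-- The field shift at root time `√θ m`: `((√θ m)²)⁻¹ • cx (θ • e) = (m²)⁻¹ • cx e`
(`θ > 0`). [folklore] -/
theorem inv_sqrt_mul_sq_smul_complexify (m : ℂ) {θ : ℝ} (hθ : 0 < θ)
    (e : EuclideanSpace ℝ ι) :
    (((((Real.sqrt θ : ℝ)) : ℂ) * m) ^ 2)⁻¹ • complexify (θ • e) = (m ^ 2)⁻¹ • complexify e := by
  rw [complexify_smul, smul_smul, mul_pow, ← Complex.ofReal_pow, Real.sq_sqrt hθ.le, mul_inv,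
    mul_assoc, mul_comm ((m ^ 2)⁻¹) _, ← mul_assoc,
    inv_mul_cancel₀ (Complex.ofReal_ne_zero.2 hθ.ne'), one_mul]

/-- **The bilinear term of covariant fields is covariant** on `schemeDomain ν T₀`: for
`p = (m, g)` and `p' = (m, g - (m²)⁻¹ cx e)` both in the domain,
`duhamelC ν V W (m, g) (x + e) = duhamelC ν V W (m, g - (m²)⁻¹ cx e) x`
(for `θ ∈ (0,1)`: translate `y ↦ y + (1-θ)e` in the inner integral; the fields, taken at root
time `√θ m`, absorb the remaining shift `θe` by their own covariance, `((√θm)²)⁻¹(θe) = m⁻²e`).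
[folklore] -/
theorem duhamelC_add_right {V W : ℂ × EuclideanSpace ℂ ι → EuclideanSpace ℝ ι → EuclideanSpace ℂ ι}
    (hV : IsGalileanCovariantOn (schemeDomain ν T₀) V)
    (hW : IsGalileanCovariantOn (schemeDomain ν T₀) W) {m : ℂ} {g : EuclideanSpace ℂ ι}
    (hp : ((m, g) : ℂ × EuclideanSpace ℂ ι) ∈ schemeDomain ν T₀) (x e : EuclideanSpace ℝ ι)
    (hp' : ((m, g - (m ^ 2)⁻¹ • complexify e) : ℂ × EuclideanSpace ℂ ι) ∈ schemeDomain ν T₀) :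
    duhamelC ν V W (m, g) (x + e) = duhamelC ν V W (m, g - (m ^ 2)⁻¹ • complexify e) x := by
  have hm : m ≠ 0 := fun h => by
    have := hp.1
    rw [h] at this
    simp at this
  set g' : EuclideanSpace ℂ ι := g - (m ^ 2)⁻¹ • complexify e with hg'
  unfold duhamelC
  simp only
  congr 1
  refine setIntegral_congr_fun measurableSet_Ioo fun θ hθ => ?_
  congr 1
  -- translate the inner integral by `(1-θ) e`
  rw [← integral_add_right_eq_self (μ := (volume : Measure (EuclideanSpace ℝ ι)))
    (fun y => oseenKernelC ((((Real.sqrt (1 - θ) : ℝ)) : ℂ) * m)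
      (complexify y - ((((1 - θ : ℝ)) : ℂ) * m ^ 2) • g)
      (V ((((Real.sqrt θ : ℝ)) : ℂ) * m, g) (x + e - y)) (W ((((Real.sqrt θ : ℝ)) : ℂ) * m, g) (x + e - y)))
    ((1 - θ) • e)]
  refine integral_congr_ae (Eventually.of_forall fun y => ?_)
  simp only
  -- the fields absorb the shift `θ e`
  have hq : (((((Real.sqrt θ : ℝ)) : ℂ) * m, g) : ℂ × EuclideanSpace ℂ ι) ∈ schemeDomain ν T₀ :=
    sqrt_mul_mem_schemeDomain hp hθ.1 hθ.2.le
  have hq' : (((((Real.sqrt θ : ℝ)) : ℂ) * m,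
      g - (((((Real.sqrt θ : ℝ)) : ℂ) * m) ^ 2)⁻¹ • complexify (θ • e)) : ℂ × EuclideanSpace ℂ ι) ∈
        schemeDomain ν T₀ := by
    rw [inv_sqrt_mul_sq_smul_complexify m hθ.1]
    exact sqrt_mul_mem_schemeDomain hp' hθ.1 hθ.2.le
  have hxe : x + e - (y + (1 - θ) • e) = (x - y) + θ • e := by
    rw [sub_smul, one_smul]; abel
  have hVq := hV _ hq (x - y) (θ • e) hq'
  have hWq := hW _ hq (x - y) (θ • e) hq'
  simp only [inv_sqrt_mul_sq_smul_complexify m hθ.1] at hVq hWq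
  rw [hxe, hVq, hWq, complexify_add_smul_sub_smul hm θ g y e]

/-- **The scheme map preserves Galilean covariance**: if `V` is covariant on `schemeDomain ν T₀`,
so is `p ↦ freeTermC b p - duhamelC ν V V p`. [folklore] -/
theorem IsGalileanCovariantOn.scheme (b : EuclideanSpace ℝ ι → EuclideanSpace ℝ ι)
    {V : ℂ × EuclideanSpace ℂ ι → EuclideanSpace ℝ ι → EuclideanSpace ℂ ι}
    (hV : IsGalileanCovariantOn (schemeDomain ν T₀) V) :
    IsGalileanCovariantOn (schemeDomain ν T₀) (fun p x => freeTermC b p x - duhamelC ν V V p x) := by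
  intro q hq z e hq'
  obtain ⟨m, g⟩ := q
  simp only
  rw [(isGalileanCovariantOn_freeTermC b ν T₀) (m, g) hq z e hq', duhamelC_add_right hV hV hq z e hq']

end Duhamel

/-! ### From covariance to the real boost identity -/

/-- **Covariance on the real axis**: a covariant field that is real on the real time axis,
`V(√(νt), 0) z = cx (v t z)` (`0 < t < T₀`), satisfies the real boost identity
`V(√(νt), cx h) x = cx (v t (x - νt·h))` whenever `(√(νt), cx h) ∈ schemeDomain ν T₀` — the
hypothesis of `OseenSchemeRealAnalytic.lean`. [folklore] -/
theorem IsGalileanCovariantOn.real_boost {ν T₀ : ℝ} (hν : 0 < ν)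
    {V : ℂ × EuclideanSpace ℂ ι → EuclideanSpace ℝ ι → EuclideanSpace ℂ ι}
    (hV : IsGalileanCovariantOn (schemeDomain ν T₀) V)
    {v : ℝ → EuclideanSpace ℝ ι → EuclideanSpace ℝ ι}
    (hreal : ∀ t ∈ Ioo 0 T₀, ∀ z, V ((((Real.sqrt (ν * t) : ℝ)) : ℂ), 0) z = complexify (v t z))
    {t : ℝ} (ht : t ∈ Ioo 0 T₀) (h x : EuclideanSpace ℝ ι)
    (hmem : (((((Real.sqrt (ν * t) : ℝ)) : ℂ), complexify h) : ℂ × EuclideanSpace ℂ ι) ∈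
      schemeDomain ν T₀) :
    V ((((Real.sqrt (ν * t) : ℝ)) : ℂ), complexify h) x = complexify (v t (x - (ν * t) • h)) := by
  set m : ℂ := (((Real.sqrt (ν * t) : ℝ)) : ℂ) with hm
  have hνt : 0 < ν * t := mul_pos hν ht.1
  have hm2 : m ^ 2 = (((ν * t : ℝ)) : ℂ) := by
    rw [hm, ← Complex.ofReal_pow, Real.sq_sqrt hνt.le]
  have hm20 : m ^ 2 ≠ 0 := by rw [hm2]; exact Complex.ofReal_ne_zero.2 hνt.ne'
  have hshift : complexify h - (m ^ 2)⁻¹ • complexify ((ν * t) • h) = (0 : EuclideanSpace ℂ ι) := by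
    rw [complexify_smul, ← hm2, smul_smul, inv_mul_cancel₀ hm20, one_smul, sub_self]
  have h0 : ((m, complexify h - (m ^ 2)⁻¹ • complexify ((ν * t) • h)) : ℂ × EuclideanSpace ℂ ι) ∈
      schemeDomain ν T₀ := by
    rw [hshift]; exact sqrt_mem_schemeDomain hν ht.1 ht.2
  have hc := hV (m, complexify h) hmem (x - (ν * t) • h) ((ν * t) • h) h0
  simp only [sub_add_cancel, hshift] at hc
  rw [hc, hreal t ht]

end Literature.Analysis.FluidPDE

end
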